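import Literature.AnabelianGeometry.AbsoluteAnabelian.ArchimedeanHolFieldFunctorGeometricRC
import HarnessLib

/-!
# [AbsTopIII] Def 4.1 (iii): the category `HolRS.RC` of connected Riemann surfaces with RC-holomorphic
# maps is inhabited (the complex plane) — census-visibility record (abc-iut-w5-d197, gen 2)

abc-iut-L4-t14's `HolRS.RC` (`ArchimedeanHolFieldFunctorGeometricRC.lean`) wraps a connected Riemann surface;
its own file exhibits the complex plane and complex conjugation (`RC.exists_antihol_aut_complexPlane`), but
only inside an `∃ φ : … ≅ …` over a fixed object, which the inhabitation census does not read as a producer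
of `RC`; the row read ZERO (v4).  This PROOF-ONLY file records the direct producers (GENUINE: the complex
plane, L4-t14's `HolRS.complexPlane`).  No side taken on [IUTchIII] Cor 3.12; typed ≠ proved.
-/

namespace Literature.AnabelianGeometry.AbsoluteAnabelian.HolRS

open _root_.CategoryTheory

/-- The complex plane is an object of `RC`. [cite: MochizukiAbsTopIII2015, Definition 4.1 (iii) p.103] -/
theorem RC.nonempty : Nonempty RC := ⟨⟨complexPlane⟩⟩

/-- Every connected Riemann surface `X : HolRS` gives the object `⟨X⟩` of `RC` (exact criterion:
`RC` is inhabited iff `HolRS` is). [cite: MochizukiAbsTopIII2015, Definition 4.1 (iii) p.103] -/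
theorem RC.nonempty_iff : Nonempty RC ↔ Nonempty HolRS := ⟨fun ⟨X⟩ => ⟨X.of⟩, fun ⟨X⟩ => ⟨⟨X⟩⟩⟩

/-- The full subcategory on ANY property containing the complex plane is inhabited; in particular for
`Q = ⊤`. [cite: MochizukiAbsTopIII2015, Definition 4.1 (iii) p.103] -/
theorem RC.exists_top : ∃ X : RC, (⊤ : ObjectProperty RC) X := ⟨⟨complexPlane⟩, trivial⟩

end Literature.AnabelianGeometry.AbsoluteAnabelian.HolRS
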